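import Summits.CriticalPhenomena.PercolationContinuityZ3.Theorems.PercNearOneGluingNoHeavyLowerTailThreePointIsoSexticPendantGraph
import HarnessLib

/-!
# The two non-port components of the `(Q6)` system through parallel composition at the three terminals — every finite weighted graph

Support file for crux `stmt-CriticalPhenomena-4575` (`NoHeavyLowerTail`), seat `prim-facecert` gen 19 (`--supports stmt-CriticalPhenomena-4575`).
Companion of `…ThreePointIsoSexticPendantGraph` (`isoSexticPort_of_pieces`, the port component) in the parallel-composition setting of prim-l12-p1
gen 21's `ThreePointIsoQuartic.isoQuartic_of_pieces` (labelling `part : V → ι`, non-terminals with different labels never joined): with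
`Q = P(a|b|c)`, `A = P(c ↮ {a,b})`, `B = P(b ↮ {a,c})`, `C = P(a ↮ {b,c})`,
* `isoSexticA_of_pieces`: per piece `Qᵢ⁶ ≤ Aᵢ³Bᵢ³Cᵢ²` (cylinder probabilities) ⟹ `Q⁶ ≤ A³B³C²`;
* `isoSexticB_of_pieces`: per piece `Qᵢ⁶ ≤ Aᵢ³Bᵢ²Cᵢ³` ⟹ `Q⁶ ≤ A³B²C³`.
Isolation coordinates multiply over pieces (`ThreePointPieces.real_isoP`, `real_sepP'`), the terminal edges contribute factors `(1−p_xy)^k ≤ (1−p_xy)^{k−1}`,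
and `ThreePointIsoSexticPendant.isoSexticPort_prod` multiplies the per-piece inequalities.  With `…ThreePointIsoSexticPendantSystem` (arm/pendant
extension, law level) and `…ThreePointIsoSexticPendantSystemGraph` (cut-vertex step) this closes the FULL `(Q6)` system on the
{parallel₃, arm/pendant, fan}-closure at graph level (lead memos `…-g115-Q6-LAW-ALGEBRA.md` §6, `…-g117-NONPORT-Q6.md`).
-/

namespace Summit.CriticalPhenomena.PercolationContinuityZ3.Theorems.ThreePointIsoSexticSystemPieces

open MeasureTheory Set
open Literature.Probability.Percolation Literature.Probability.LatticeModels
open Summit.CriticalPhenomena.PercolationContinuityZ3.Theorems.ThreePointIsoSexticPendant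
open Summit.CriticalPhenomena.PercolationContinuityZ3.Theorems.ThreePointHubEvents (real_tClosed real_tClosed_inter)
open Summit.CriticalPhenomena.PercolationContinuityZ3.Theorems.ThreePointPieces

variable {V : Type*} [Fintype V] [DecidableEq V] {ι : Type*} [Fintype ι] [DecidableEq ι]

/-! ## Parallel composition at the three terminals -/

/-- **The `I_a`-component of `(Q6)` for parallel compositions** (setting of `ThreePointIsoQuartic.isoQuartic_of_pieces`): per piece
`Qᵢ⁶ ≤ Aᵢ³·Bᵢ³·Cᵢ²` (cylinder probabilities, `Cᵢ = P(a isolated inside i)`) ⟹ `P(a|b|c)⁶ ≤ P(c ↮ {a,b})³ · P(b ↮ {a,c})³ · P(a ↮ {b,c})²`. [this work] -/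
theorem isoSexticA_of_pieces (w : Sym2 V → unitInterval) {a b c : V} (hab : a ≠ b) (hac : a ≠ c) (hbc : b ≠ c)
    (part : V → ι) (hw : ∀ u v : V, u ∉ terms a b c → v ∉ terms a b c → part u ≠ part v → (w s(u, v) : ℝ) = 0)
    (h6 : ∀ i, (prodBernoulli w).real (isoPiece (piecePairs a b c part i) a b c ∩ isoPiece (piecePairs a b c part i) b a c) ^ 6 ≤
      (prodBernoulli w).real (isoPiece (piecePairs a b c part i) c a b) ^ 3 *
        (prodBernoulli w).real (isoPiece (piecePairs a b c part i) b a c) ^ 3 *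
          (prodBernoulli w).real (isoPiece (piecePairs a b c part i) a b c) ^ 2) :
    (prodBernoulli w).real ((openConn a b)ᶜ ∩ (openConn a c)ᶜ ∩ (openConn b c)ᶜ) ^ 6 ≤
      (prodBernoulli w).real ((openConn a c)ᶜ ∩ (openConn b c)ᶜ) ^ 3 *
        (prodBernoulli w).real ((openConn a b)ᶜ ∩ (openConn b c)ᶜ) ^ 3 *
          (prodBernoulli w).real ((openConn a b)ᶜ ∩ (openConn a c)ᶜ) ^ 2 := by
  have hN : (prodBernoulli w).real (badP a b c part) = 0 := real_badP w a b c part hw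
  set μ := prodBernoulli w with hμ
  set IA : Set (BondConfig V) := (openConn a b)ᶜ ∩ (openConn a c)ᶜ with hIA
  set IB : Set (BondConfig V) := (openConn a b)ᶜ ∩ (openConn b c)ᶜ with hIB
  set IC : Set (BondConfig V) := (openConn a c)ᶜ ∩ (openConn b c)ᶜ with hIC
  have hsep : (openConn a b)ᶜ ∩ (openConn a c)ᶜ ∩ (openConn b c)ᶜ = IA ∩ IB := by
    ext ω
    simp only [hIA, hIB, mem_inter_iff, mem_compl_iff]
    tauto
  rw [hsep]
  set F : ι → Finset (Sym2 V) := fun i => piecePairs a b c part i with hF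
  set PQ : ℝ := ∏ i ∈ (Finset.univ : Finset ι), μ.real (isoPiece (F i) a b c ∩ isoPiece (F i) b a c) with hPQ
  set PA : ℝ := ∏ i ∈ (Finset.univ : Finset ι), μ.real (isoPiece (F i) c a b) with hPA
  set PB : ℝ := ∏ i ∈ (Finset.univ : Finset ι), μ.real (isoPiece (F i) b a c) with hPB
  set PC : ℝ := ∏ i ∈ (Finset.univ : Finset ι), μ.real (isoPiece (F i) a b c) with hPC
  set pab : ℝ := (w s(a, b) : ℝ)
  set pac : ℝ := (w s(a, c) : ℝ)
  set pbc : ℝ := (w s(b, c) : ℝ)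
  have hpab : 0 ≤ 1 - pab := sub_nonneg.2 (unitInterval.le_one _)
  have hpac : 0 ≤ 1 - pac := sub_nonneg.2 (unitInterval.le_one _)
  have hpbc : 0 ≤ 1 - pbc := sub_nonneg.2 (unitInterval.le_one _)
  have hpab1 : 1 - pab ≤ 1 := sub_le_self _ (unitInterval.nonneg _)
  have hpac1 : 1 - pac ≤ 1 := sub_le_self _ (unitInterval.nonneg _)
  have eQ : μ.real (IA ∩ IB) = (1 - pab) * (1 - pac) * (1 - pbc) * PQ := by
    rw [hIA, hIB, hμ, real_sepP' w part hab hac hbc hN, real_sepP, real_tClosed_inter w hab hac hbc]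
  have eA : μ.real IC = (1 - pac) * (1 - pbc) * PA := by
    rw [hIC, hμ, real_isoPc w part hac hbc hN, real_isoP w a b c part (mem_terms.2 (Or.inr (Or.inr rfl))) (mem_terms.2 (Or.inl rfl))
      (mem_terms.2 (Or.inr (Or.inl rfl))), real_tClosed w hab, Sym2.eq_swap (a := c) (b := a), Sym2.eq_swap (a := c) (b := b)]
  have eB : μ.real IB = (1 - pab) * (1 - pbc) * PB := by
    rw [hIB, hμ, real_isoPb w part hab hbc hN, real_isoP w a b c part (mem_terms.2 (Or.inr (Or.inl rfl))) (mem_terms.2 (Or.inl rfl))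
      (mem_terms.2 (Or.inr (Or.inr rfl))), real_tClosed w hac, Sym2.eq_swap (a := b) (b := a)]
  have eC : μ.real IA = (1 - pab) * (1 - pac) * PC := by
    rw [hIA, hμ, real_isoPa w part hab hac hN, real_isoP w a b c part (mem_terms.2 (Or.inl rfl)) (mem_terms.2 (Or.inr (Or.inl rfl)))
      (mem_terms.2 (Or.inr (Or.inr rfl))), real_tClosed w hbc]
  have hPQnn : 0 ≤ PQ := Finset.prod_nonneg fun _ _ => measureReal_nonneg
  have hprod : PQ ^ 6 ≤ PA ^ 3 * PB ^ 3 * PC ^ 2 :=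
    isoSexticPort_prod Finset.univ _ _ _ _ (fun _ _ => measureReal_nonneg) fun i _ => h6 i
  have hcoef : ((1 - pab) * (1 - pac) * (1 - pbc)) ^ 6 ≤ (1 - pab) ^ 5 * (1 - pac) ^ 5 * (1 - pbc) ^ 6 := by
    have h1 : (1 - pab) ^ 6 ≤ (1 - pab) ^ 5 := pow_le_pow_of_le_one hpab hpab1 (by norm_num)
    have h2 : (1 - pac) ^ 6 ≤ (1 - pac) ^ 5 := pow_le_pow_of_le_one hpac hpac1 (by norm_num)
    calc ((1 - pab) * (1 - pac) * (1 - pbc)) ^ 6 = ((1 - pab) ^ 6 * (1 - pac) ^ 6) * (1 - pbc) ^ 6 := by ring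
      _ ≤ ((1 - pab) ^ 5 * (1 - pac) ^ 5) * (1 - pbc) ^ 6 :=
          mul_le_mul_of_nonneg_right (mul_le_mul h1 h2 (pow_nonneg hpac 6) (pow_nonneg hpab 5)) (pow_nonneg hpbc 6)
      _ = (1 - pab) ^ 5 * (1 - pac) ^ 5 * (1 - pbc) ^ 6 := by ring
  rw [eQ, eA, eB, eC]
  calc ((1 - pab) * (1 - pac) * (1 - pbc) * PQ) ^ 6 = ((1 - pab) * (1 - pac) * (1 - pbc)) ^ 6 * PQ ^ 6 := by ring
    _ ≤ ((1 - pab) ^ 5 * (1 - pac) ^ 5 * (1 - pbc) ^ 6) * (PA ^ 3 * PB ^ 3 * PC ^ 2) :=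
        mul_le_mul hcoef hprod (pow_nonneg hPQnn 6) (by positivity)
    _ = ((1 - pac) * (1 - pbc) * PA) ^ 3 * ((1 - pab) * (1 - pbc) * PB) ^ 3 * ((1 - pab) * (1 - pac) * PC) ^ 2 := by ring


/-- **The `I_b`-component of `(Q6)` for parallel compositions**: per piece `Qᵢ⁶ ≤ Aᵢ³·Bᵢ²·Cᵢ³` (`Bᵢ = P(b isolated inside i)`)
⟹ `P(a|b|c)⁶ ≤ P(c ↮ {a,b})³ · P(b ↮ {a,c})² · P(a ↮ {b,c})³`. [this work] -/
theorem isoSexticB_of_pieces (w : Sym2 V → unitInterval) {a b c : V} (hab : a ≠ b) (hac : a ≠ c) (hbc : b ≠ c)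
    (part : V → ι) (hw : ∀ u v : V, u ∉ terms a b c → v ∉ terms a b c → part u ≠ part v → (w s(u, v) : ℝ) = 0)
    (h6 : ∀ i, (prodBernoulli w).real (isoPiece (piecePairs a b c part i) a b c ∩ isoPiece (piecePairs a b c part i) b a c) ^ 6 ≤
      (prodBernoulli w).real (isoPiece (piecePairs a b c part i) c a b) ^ 3 *
        (prodBernoulli w).real (isoPiece (piecePairs a b c part i) b a c) ^ 2 *
          (prodBernoulli w).real (isoPiece (piecePairs a b c part i) a b c) ^ 3) :
    (prodBernoulli w).real ((openConn a b)ᶜ ∩ (openConn a c)ᶜ ∩ (openConn b c)ᶜ) ^ 6 ≤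
      (prodBernoulli w).real ((openConn a c)ᶜ ∩ (openConn b c)ᶜ) ^ 3 *
        (prodBernoulli w).real ((openConn a b)ᶜ ∩ (openConn b c)ᶜ) ^ 2 *
          (prodBernoulli w).real ((openConn a b)ᶜ ∩ (openConn a c)ᶜ) ^ 3 := by
  have hN : (prodBernoulli w).real (badP a b c part) = 0 := real_badP w a b c part hw
  set μ := prodBernoulli w with hμ
  set IA : Set (BondConfig V) := (openConn a b)ᶜ ∩ (openConn a c)ᶜ with hIA
  set IB : Set (BondConfig V) := (openConn a b)ᶜ ∩ (openConn b c)ᶜ with hIB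
  set IC : Set (BondConfig V) := (openConn a c)ᶜ ∩ (openConn b c)ᶜ with hIC
  have hsep : (openConn a b)ᶜ ∩ (openConn a c)ᶜ ∩ (openConn b c)ᶜ = IA ∩ IB := by
    ext ω
    simp only [hIA, hIB, mem_inter_iff, mem_compl_iff]
    tauto
  rw [hsep]
  set F : ι → Finset (Sym2 V) := fun i => piecePairs a b c part i with hF
  set PQ : ℝ := ∏ i ∈ (Finset.univ : Finset ι), μ.real (isoPiece (F i) a b c ∩ isoPiece (F i) b a c) with hPQ
  set PA : ℝ := ∏ i ∈ (Finset.univ : Finset ι), μ.real (isoPiece (F i) c a b) with hPA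
  set PB : ℝ := ∏ i ∈ (Finset.univ : Finset ι), μ.real (isoPiece (F i) b a c) with hPB
  set PC : ℝ := ∏ i ∈ (Finset.univ : Finset ι), μ.real (isoPiece (F i) a b c) with hPC
  set pab : ℝ := (w s(a, b) : ℝ)
  set pac : ℝ := (w s(a, c) : ℝ)
  set pbc : ℝ := (w s(b, c) : ℝ)
  have hpab : 0 ≤ 1 - pab := sub_nonneg.2 (unitInterval.le_one _)
  have hpac : 0 ≤ 1 - pac := sub_nonneg.2 (unitInterval.le_one _)
  have hpbc : 0 ≤ 1 - pbc := sub_nonneg.2 (unitInterval.le_one _)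
  have hpab1 : 1 - pab ≤ 1 := sub_le_self _ (unitInterval.nonneg _)
  have hpbc1 : 1 - pbc ≤ 1 := sub_le_self _ (unitInterval.nonneg _)
  have eQ : μ.real (IA ∩ IB) = (1 - pab) * (1 - pac) * (1 - pbc) * PQ := by
    rw [hIA, hIB, hμ, real_sepP' w part hab hac hbc hN, real_sepP, real_tClosed_inter w hab hac hbc]
  have eA : μ.real IC = (1 - pac) * (1 - pbc) * PA := by
    rw [hIC, hμ, real_isoPc w part hac hbc hN, real_isoP w a b c part (mem_terms.2 (Or.inr (Or.inr rfl))) (mem_terms.2 (Or.inl rfl))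
      (mem_terms.2 (Or.inr (Or.inl rfl))), real_tClosed w hab, Sym2.eq_swap (a := c) (b := a), Sym2.eq_swap (a := c) (b := b)]
  have eB : μ.real IB = (1 - pab) * (1 - pbc) * PB := by
    rw [hIB, hμ, real_isoPb w part hab hbc hN, real_isoP w a b c part (mem_terms.2 (Or.inr (Or.inl rfl))) (mem_terms.2 (Or.inl rfl))
      (mem_terms.2 (Or.inr (Or.inr rfl))), real_tClosed w hac, Sym2.eq_swap (a := b) (b := a)]
  have eC : μ.real IA = (1 - pab) * (1 - pac) * PC := by
    rw [hIA, hμ, real_isoPa w part hab hac hN, real_isoP w a b c part (mem_terms.2 (Or.inl rfl)) (mem_terms.2 (Or.inr (Or.inl rfl)))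
      (mem_terms.2 (Or.inr (Or.inr rfl))), real_tClosed w hbc]
  have hPQnn : 0 ≤ PQ := Finset.prod_nonneg fun _ _ => measureReal_nonneg
  have hprod : PQ ^ 6 ≤ PA ^ 3 * PC ^ 3 * PB ^ 2 :=
    isoSexticPort_prod Finset.univ _ _ _ _ (fun _ _ => measureReal_nonneg) fun i _ => (h6 i).trans_eq (by ring)
  have hcoef : ((1 - pab) * (1 - pac) * (1 - pbc)) ^ 6 ≤ (1 - pab) ^ 5 * (1 - pac) ^ 6 * (1 - pbc) ^ 5 := by
    have h1 : (1 - pab) ^ 6 ≤ (1 - pab) ^ 5 := pow_le_pow_of_le_one hpab hpab1 (by norm_num)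
    have h2 : (1 - pbc) ^ 6 ≤ (1 - pbc) ^ 5 := pow_le_pow_of_le_one hpbc hpbc1 (by norm_num)
    calc ((1 - pab) * (1 - pac) * (1 - pbc)) ^ 6 = ((1 - pab) ^ 6 * (1 - pbc) ^ 6) * (1 - pac) ^ 6 := by ring
      _ ≤ ((1 - pab) ^ 5 * (1 - pbc) ^ 5) * (1 - pac) ^ 6 :=
          mul_le_mul_of_nonneg_right (mul_le_mul h1 h2 (pow_nonneg hpbc 6) (pow_nonneg hpab 5)) (pow_nonneg hpac 6)
      _ = (1 - pab) ^ 5 * (1 - pac) ^ 6 * (1 - pbc) ^ 5 := by ring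
  rw [eQ, eA, eB, eC]
  calc ((1 - pab) * (1 - pac) * (1 - pbc) * PQ) ^ 6 = ((1 - pab) * (1 - pac) * (1 - pbc)) ^ 6 * PQ ^ 6 := by ring
    _ ≤ ((1 - pab) ^ 5 * (1 - pac) ^ 6 * (1 - pbc) ^ 5) * (PA ^ 3 * PC ^ 3 * PB ^ 2) :=
        mul_le_mul hcoef hprod (pow_nonneg hPQnn 6) (by positivity)
    _ = ((1 - pac) * (1 - pbc) * PA) ^ 3 * ((1 - pab) * (1 - pbc) * PB) ^ 2 * ((1 - pab) * (1 - pac) * PC) ^ 3 := by ring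


end Summit.CriticalPhenomena.PercolationContinuityZ3.Theorems.ThreePointIsoSexticSystemPieces
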